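import Mathlib
import HarnessLib
import HarnessLib.Audit
import Summits.RiemannHypothesis.Statement
import Literature.NumberTheory.LFunctions.WeilExplicit
import Literature.NumberTheory.LFunctions.UniformWeilPositivityRH
import Literature.NumberTheory.LFunctions.WeilGroundEnergyProofs
import HarnessLib.Audit.Status.Attr

/-!
Route: WeilWindowFlow

DORMANT since 2026-08-26T16:58:04Z (reconciler: no traction for 5.2 d (last activity item-evidence-added at 2026-08-21T11:32:57Z); parked, not closed — `ledger route dormant route-RiemannHypothesis-WeilWindowFlow --off` to reactivate) — unstaffed, not closed; items shared with open routes are served there. `ledger route dormant <id> --off` reactivates.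

Route WeilWindowFlow — "no conjugate point along the window" (realises idea card weil-window-flow).
THESIS X (words). Let eps(a) := weilGroundEnergy a, the bottom of Weil's quadratic form Q(g) = Re
W(g * g~) over L2-normalised test functions supported in [-a, a] (Bombieri's mu(M), M = e^a;
Connes's smallest eigenvalue of QW_lambda, lambda = e^a). X: eps obeys a GROENWALL LEAKAGE LAW along
the window parameter — there is a rate C, locally integrable on (0, oo), with eps(a) >= eps(b) *
exp(-int_b^a C) for all 0 < b <= a. Equivalently: log eps is finite and locally absolutely
continuous on (0, oo); positivity, once present, decays at a locally integrable relative rate and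
never reaches a conjugate point a* (first window with ker Q_{a*} != 0).
X (Lean, decl GronwallLeakage, elaborated in Sketch.lean): `∃ C : ℝ → ℝ, ∀ b a : ℝ, 0 < b → b ≤ a →
IntervalIntegrable C volume b a ∧ Literature.NumberTheory.LFunctions.weilGroundEnergy b * Real.exp
(-(∫ x in b..a, C x)) ≤ Literature.NumberTheory.LFunctions.weilGroundEnergy a`.
ASSEMBLY X → Summit.RiemannHypothesis is provable NOW from PROVED tree facts only: the coercive
anchor Literature.NumberTheory.LFunctions.weilQuadratic_coercive (eps(a0) >= 1 for some a0 > 0,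
Bombieri2000Weil Thm 12), then eps(a) > 0 for every a >= a0 by X, hence WeilPositivityOn a
(weilGroundEnergy_nonneg_iff_holds), WeilPositivityOn.mono below a0, and
riemannHypothesis_iff_forall_weilPositivityOn (weil_criterion_holds, Yoshida's criterion). So it
suffices to show X. The route's content is HOW X is to be shown: treat a as TIME. (i)
Hadamard/dilation variation: the one-sided derivative of eps at a is bounded by the dilation VIRIAL
of the minimiser phi_a (Bombieri2000Weil Thm 5 proof; edge Dirac masses of extremals, Lemma 5;
Krein–Bellman endpoint variation for interval-truncated kernels); (ii) LEAKAGE INEQUALITY -eps' <=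
C(a) eps with C locally bounded/integrable (crux DiniLeakage, RH-strength: a minimiser cannot leak
through the window edge faster than its own energy allows); (iii) Groenwall from the proved coercive
rung. Regularity checkpoint (crux WindowLipschitz, unconditional) and the first Groenwall step past
the proved archimedean rung — Weil positivity on some window containing the prime 2 (crux
PrimeTwoWindow) — are the other ranked cruxes; continuity of eps (Bombieri Thm 5), strictness at the
dyadic window, RH-calibration and the Dini→integral glue are support.

Rationale: WHY THIS LINE. Imports from calculus of variations / spectral flow: Hadamard domain-variation of a
bottom eigenvalue and Dini–Groenwall comparison, applied to Bombieri's variational theory of the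
truncated Weil form (Bombieri2000Weil §§4–7). Every other Weil-positivity line (route WeilPos; cards
weil-levy-generator, weil-ground-state-perron-frobenius, weil-ladder-adversary) attacks ONE window
at a time; here the infinitely many inequalities eps(a) >= 0 become ONE differential inequality
along a, anchored at a rung that is already a kernel-checked theorem (weilQuadratic_coercive,
weilPositivityOn_log_two_half_holds). The unknown becomes a property of minimisers of a linear
delay–integral Euler–Lagrange system (delays log n, n < e^{2a}; Bombieri2000Weil §§4–7; kernel
explicit and trace class, Suzuki2023 = arXiv:2206.03682 §6): edge/virial concentration versus
energy. Numerics are consistent: the bottom is lowered, not killed, when p = 2 enters (e^L in (2,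
2.27)) and log s(L) is linear in mu = e^L down to 2.4e-48 at lambda^2 = 11 (arXiv:2106.01715
§§2.3–2.5), i.e. relative rate C(a) ~ c e^{2a}: locally bounded, exactly what Groenwall tolerates
and a uniform-margin argument (Newman barrier) does not. DECIDING THEOREM (rev 2, D-0027 §2.1):
`closes : GronwallLeakage → Summit.RiemannHypothesis` is PROVED in the route file from tree facts
only (weilQuadratic_coercive 0 ⇒ eps >= 0 on (0, a0] via weilGroundEnergy_nonneg_iff_holds; the
leakage law transports eps >= 0 to [a0, oo); weilGroundEnergy_nonneg_iff_holds;
riemannHypothesis_iff_forall_weilPositivityOn; Summit.RiemannHypothesis_iff — strictness of eps is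
never needed), so the route decides RH from its target X alone; the Assembly item (GronwallLeakage →
Summit.RiemannHypothesis) is the same implication and is settled by citing `closes` (candidate
proofs also attached to it by the route review and the grounder).
RANKED CRUXES. #2 DiniLeakage — upper-Dini form of -eps' <= K eps with K uniform on compact windows
[b0, A]: the bet; RH-strength given the rest (why it might fail: needs virial(phi_a) <= a K eps(a)
||phi_a||^2 while eps(a) ~ e^{-c e^{2a}}, arXiv:2106.01715 §2.5; the global input a semilocal cutoff
lacks, arXiv:1910.14368 §1; sources Bombieri2000Weil Thm 5, arXiv:2206.03682 Thm 1.4). #3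
WindowLipschitz — eps locally Lipschitz on (0, oo): the quantitative Hadamard checkpoint
(Bombieri2000Weil Thm 5 proves continuity only; minimiser regularity open, p.12); unconditional,
open, decides whether locally BOUNDED rates are even possible; nearest engine found by the route
review: the window bottom is a compact perturbation of the 1-D Dirichlet LOGARITHMIC LAPLACIAN form
(Chen–Weth 2019 arXiv:1710.03416; Laptev–Weth arXiv:2009.03395; Feulefack–Jarohs–Weth
arXiv:2010.10448), which reduces the Lipschitz bound to a finite-virial statement at the edge.
SUPPORT (unranked): PrimeTwoWindow (EXISTS a > (log 2)/2 with WeilPositivityOn a; retriaged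
crux→support 2026-08-15: RH-implied milestone, numerically settled arXiv:2106.01715 §§2.2–2.3, =
StrictArchimedeanBottom + WindowContinuity here; still crux r3 of WeilPos, shared item);
WindowContinuity (Bombieri2000Weil Thm 5 + Thm 3 compactness, transported to the smooth-inf eps by
H^log-density); StrictArchimedeanBottom (0 < eps((log 2)/2); numerically ~1e-3, ConnesConsani2021,
arXiv:2106.01715 Fig. testeven2; certificate slack or attainment + definiteness); StrictUnderRH (RH
→ eps(a) > 0 for all a: explicit formula + Beurling/Ortega-Cerdà–Seip sampling for PW_a on a
separated subsequence of zeta ordinates of density > a/pi, Littlewood's gap theorem Titchmarsh1986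
§9.12 — calibrates that X is not stronger than RH modulo regularity); DiniGlue (DiniLeakage →
WindowContinuity → GronwallLeakage: Dini monotonicity lemma, Mathlib
image_le_of_liminf_slope_right_* idiom, plus the proved coercive anchor to exclude eps <= 0).
LOGICAL STATUS, stated plainly: X <=> RH ∧ (log eps locally AC on (0, oo)); the second conjunct is
expected unconditionally (WindowLipschitz would give it). The route does not claim X is weaker than
RH; it claims a MECHANISM (variation formula + leakage + Groenwall) with separately falsifiable
checkpoints (WindowLipschitz, PrimeTwoWindow, numerics).
KILL CRITERIA. (k1) kit numerics of eps(a) on a in [0.2, 1.3] (Connes–Consani sigma± matrices in the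
U^k basis, or sinc collocation of Suzuki's kernel; primes <= 13): if -Delta log eps / Delta a spikes
non-integrably (e.g. at a = (log n)/2) or eps shows vertical tangents, DiniLeakage/WindowLipschitz
die and only the reformulation survives → close exhausted. (k2) A refutation of WindowLipschitz
(vertical tangent) demotes the route to integrable rates; a refutation of WindowContinuity in the
smooth-inf normalisation kills DiniGlue. (k3) PrimeTwoWindow refuted (eps < 0 just beyond (log 2)/2)
refutes RH itself. (k4) A no-go showing the minimiser virial bound needs zero locations
(Connes–Consani arXiv:1910.14368 §1 diagnosis made sharp) closes the route as a reformulation.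
NOT DECOMPOSED YET. Second layer, after a crux closes: the Hadamard identity D^-eps(a) = -(virial of
phi_a)/a as an item (definitions weilDilationVirial / weilDilate / IsWeilGroundState exist in the
tree; the missing piece is the variation theorem hasDerivAt_re_weilQuadratic_weilDilate plus
minimiser existence in the form domain, Bombieri2000Weil Thm 3); even/odd splitting mu±; explicit
envelope C(a) <= c e^{2a} (an explicit-envelope restate of DiniLeakage is the tenure candidate
flagged by retriage); the thermometer law of card weil-thermometer-theta-exponent. No
operator/adele-class objects are posited.
CHEAPEST FALSIFIER. The k1 numerics: tabulate eps(a) = smallest eigenvalue of the truncated Weil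
form on a grid a in [0.3, 1.3] (across the entries of p = 2, 3, 4, 5, 7; method of arXiv:2106.01715
§§2.2–2.5, primes <= 13) and the difference quotient -Delta log eps / Delta a; a non-integrable
spike at some a = (log n)/2 or a vertical tangent of eps kills DiniLeakage and WindowLipschitz at
once (only the reformulation X <=> RH ∧ regularity survives); eps < 0 anywhere refutes RH. Existing
data (arXiv:2106.01715 Fig. testeven2, §2.5: log s linear in e^L) show kinks, not spikes.

Novelty: Nearest prior art (searched: card + novelty audit 2026-08-15 — zbMATH x5, local lit, galaxy
saturated, Bombieri2000Weil pp.13–18 READ, Suzuki arXiv:1606.05726 Thm 9.1 READ; this session — lit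
frontier RiemannHypothesis --since 2021, lit search --hybrid 'smallest eigenvalue of the truncated
Weil form as a function of the cutoff', reads of arXiv:2106.01715 §2 (pp.3,9,10), arXiv:2511.23257
(grep), arXiv:2601.12133, arXiv:2602.04022 §§2,6 (grep), Bombieri2000Weil Thms 3–5/Lemma 5
pp.13–18): (i) Bombieri2000Weil — the variational set-up: Thm 3 (inf attained in L2), Thm 5 (mu±(M)
continuous decreasing, by the dilation variation f_eps = (1+eps)^{1/2} x^{eps/2} f(x^{1+eps})),
Lemma 5 (D^2 f of an extremal = bounded + two edge Diracs), §7 (Fredholm determinant D(Lambda, t) in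
the window t); (ii) Yoshida1992 / Suzuki2023 (doi:10.1112/jlms.12785 Thm 1.4): RH <=> non-degenerate
for every window; Suzuki arXiv:1606.05726 Thm 9.1: zero-free half-planes <=> canonical systems H(t)
extend along t (a 'no degeneracy along t' criterion); (iii) Krein–Bellman endpoint variation of
interval-truncated Fredholm data (Tracy–Widom arXiv:hep-th/9306042) — the right engine for the
variation lemma; (iv) ConnesConsani2021 + arXiv:2106.01715 §§2.3–2.5: numerics of the bottom across
p = 2 and its exponential decay in e^L. DELTA: nobody in the searched literature treats the window
as TIME with an ODE certificate — the Groenwall closure -eps' <= C(a) eps with C in L1_loc anchored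
at the PROVED coercive/archimed  [refs: 10.1112/jlms.12785, 1606.05726, 2106.01715, 2511.23257, 2601.12133, 2602.04022, hep-th/9306042, doi:10.1112/jlms.12785, Yoshida1992, Suzuki2023, ConnesConsani2021]

Barriers (technique_class: Weil-positivity window-flow Hadamard-variation Gronwall): technique_class: Weil-positivity window-flow Hadamard-variation Gronwall
- Literature.Barriers.RiemannHypothesis.NewmanConjecture: applies in spirit (RH 'barely true';
eps(a) -> 0+ super-exponentially, 2.389e-48 at lambda^2 = 11, arXiv:2106.01715 §2.5): evaded because
Groenwall needs no uniform margin, only a locally integrable RELATIVE rate; numerics give C(a) ~ c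
e^{2a}, locally bounded. Dies if C is provably non-integrable at a finite window under RH.
- Literature.Barriers.RiemannHypothesis.DeBrangesPositivity: not engaged — every item is RH-implied
(eps >= 0 is RH-equivalent by weil_criterion_holds; strictness from zero density/sampling), unlike
de Branges' stronger kernel condition refuted by Conrey–Li; the leakage inequality concerns
minimisers of Weil's own form, not a sign at individual zeros (refuters should still test the virial
cancellation with zeros near gamma ~ 111.03).
- Literature.Barriers.RiemannHypothesis.JensenPolynomials: analogous warning accepted — each finite
window is 'RH to a rung' and says nothing global; the route's content is the a-local rate, and it
dies if the rate cannot be bounded without locating zeros.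
- Literature.Barriers.RiemannHypothesis.LittlewoodOscillation: not in class — no one-signed
prime-counting error is used; primes enter only as delays log n of the Euler–Lagrange system.
- Uncatalogued, load-bearing: Connes–Consani's diagnosis that a purely semi-local cutoff cannot give
positivity without global (Poisson) input (arXiv:1910.14368

Novelty grade: new-combination — ROUTE REVIEW (refuter d9e80d69, 2026-08-15; 2nd pass after f1c63249's item review). GRADE new-combination (= card audit): known reformulation (Bombieri truncated variational problem + Yoshida/Suzuki non-degeneracy at every window) + classical engine (Hadamard/dilation variation, Dini–Grönwall) + new (refuter refuter-rreview-route-RiemannHypothesis--d9e80d69-0, 2026-08-15T13:58:44Z; prior: Bombieri2000Weil Thms 3–5, Lemma 5, §7 (variational set-up, continuity of the bottom, dilation variation), Yoshida1992 / Suzuki2023 doi:10.1112/jlms.12785 Thm 1.4; Suzuki arXiv:1606.05726 Thm 9.1 (non-degeneracy along the window), ConnesConsani2021 arXiv:2006.13771 + arXiv:2106.01715 §§2.3–2.5 (numerics of the bottom), Tracy–Widom arXiv:hep-th/9306042 (Krein–Bellman endpoint variation), Chen–Weth )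

History (route lifecycle, newest last):
- 2026-08-16T04:16:47Z · AUTO-CRUX (backfill): GronwallLeakage — hypotheses of the deciding theorem that nothing in the route derives are cruxes (operator:999:1085951)
- 2026-08-18T18:10:31Z · skeleton.hides-summit: strictPos_iff_riemannHypothesis (stmt-RiemannHypothesis-1037) ⟷ summit (accepted theorem in Summits/RiemannHypothesis/RiemannHypothesis/Theorems/SoloInformedNonDegenerate.lean) (solo-solo-RiemannHypothesis-informed-g18-0)
- 2026-08-26T16:58:04Z · DORMANT — reconciler: no traction for 5.2 d (last activity item-evidence-added at 2026-08-21T11:32:57Z); parked, not closed — `ledger route dormant route-RiemannHypothesi (operator:999:3266029)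

sub-problem: RiemannHypothesis · status: dormant · opened planner-plancard-RiemannHypothesis-RiemannHyp-7bed4111-0 2026-08-15T10:47:41Z · rev 3 · ledger route-RiemannHypothesis-WeilWindowFlow
GENERATED by the gate from the ledger (D-0016/17). Provers cite these decls: `theorem foo : Summit.RiemannHypothesis.RiemannHypothesis.Theses.WeilWindowFlow.<Decl> := …` in Summits/RiemannHypothesis/RiemannHypothesis/Theorems/<Name>.lean.
-/

namespace Summit.RiemannHypothesis.RiemannHypothesis.Theses.WeilWindowFlow

open scoped BigOperators Topology Manifold Classical MeasureTheory ProbabilityTheory Matrix InnerProductSpace ComplexConjugate ContinuousMap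
open Filter Set Function TopologicalSpace MeasureTheory

attribute [summit_statement] _root_.Summit.RiemannHypothesis

open Summit

/-- item stmt-RiemannHypothesis-1037 · crux (kind.auto-crux: conjecture-grade) · rank 0 · open · by planner
why it might fail: With the proved coercive anchor, X ⟺ (ε>0 at every window) ∧ (log ε locally AC): false iff RH fails (ε<0 somewhere) or, under RH, ε has a conjugate point/singular drop (excluded only conjecturally: StrictUnderRH, WindowLipschitz). No margin: bottom 2.4e-48 at λ²=11 (2106.01715 §2.5).
sources: Bombieri2000Weil (§4 Problems 1–2; Thm 3, Thm 5, PDF pp.14–16), arXiv:2106.01715 (§2.5; p.3: 2.389e-48 at λ²=11), Yoshida1992, lean: Literature.NumberTheory.LFunctions.riemannHypothesis_iff_forall_weilPositivityOn, weilQuadratic_coercive, weilGroundEnergy_nonneg_iff_holds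
[target] Thesis X: Groenwall leakage law for the window bottom eps = weilGroundEnergy on (0, oo):
one rate C, interval-integrable on every [b, a], with eps(a) >= eps(b) exp(-int_b^a C). Equivalent
to: log eps finite and locally AC on (0, oo) (take C = -(log eps)' a.e.). With the proved coercive
anchor it gives eps > 0 at every window, hence RH (Assembly). Sources: Bombieri2000Weil §4 (eps),
Thm 5; card weil-window-flow. -/
@[route_item "route-RiemannHypothesis-WeilWindowFlow", crux]
def GronwallLeakage : Prop :=
  ∃ C : ℝ → ℝ, ∀ b a : ℝ, 0 < b → b ≤ a → IntervalIntegrable C volume b a ∧ Literature.NumberTheory.LFunctions.weilGroundEnergy b * Real.exp (-(∫ x in b..a, C x)) ≤ Literature.NumberTheory.LFunctions.weilGroundEnergy a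

/-- item stmt-RiemannHypothesis-1038 · crux · rank 2 · open · by planner
why it might fail: RH-strength (+WindowContinuity+anchor ⟹ RH via DiniGlue). As stated (K free on each [b₀,A]) it is ε>0 at every window + a local relative-Lipschitz bound; the mechanism needs virial(φ_a) ≤ aKε(a)‖φ_a‖² while ε(a)~e^{-c e^{2a}} (2106.01715 §2.5): global input a semilocal cutoff lacks (1910.14368 §1).
sources: Bombieri2000Weil (Thm 5 dilation variation, PDF p.16; E–L (4.2) for the L² problem; Lemma 6), arXiv:2106.01715 (§2.3 p=2 lowers the bottom on e^L∈(2,2.27); §2.5 exponential smallness), arXiv:1910.14368 (§1 p.3: semilocal approach needs the global Poisson formula; Conj. 4.1), arXiv:2206.03682 (Suzuki2023 Thm 1.4: RH ⟺ non-degenerate at every window), arXiv:hep-th/9306042 (Krein–Bellman endpoint variation)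
[crux] The leakage inequality in derivative-free upper-Dini form: on every compact window range [b0,
A] there is K with D^+(-eps)(a) <= K eps(a), stated as 'for arbitrarily small h > 0, eps(a) -
eps(a+h) <= h (K eps(a) + eta)'. Intended proof (the mechanism): compress a (near-)minimiser phi at
window a+h to window a by Bombieri's dilation f -> (1+e)^{1/2} x^{e/2} f(x^{1+e}); the first-order
change of Q is the dilation VIRIAL of phi (polar + archimedean parts are O(||phi||^2/a); the prime
part is -Sum Lambda(n) n^{-1/2} 2Re k'(log n) log n, k = phi*phi~), and the claim is virial(phi_a)
<= a K eps(a) ||phi_a||^2 — a minimiser cannot leak through the edge faster than its energy allows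
(near-total cancellation between archimedean drift and prime delays, i.e. the explicit formula at
the minimiser: Bombieri2000Weil Lemma 6, Suzuki2023 Thm 6.1). Matches Mathlib's `∃ᶠ z in 𝓝[>] a`
slope idiom (image_le_of_liminf_slope_right_*). With WindowContinuity and the proved coercive anchor
it yields GronwallLeakage (DiniGlue). -/
@[route_item "route-RiemannHypothesis-WeilWindowFlow", crux]
def DiniLeakage : Prop :=
  ∀ b₀ A : ℝ, 0 < b₀ → b₀ ≤ A → ∃ K : ℝ, ∀ a : ℝ, b₀ ≤ a → a ≤ A → ∀ η δ : ℝ, 0 < η → 0 < δ → ∃ h : ℝ, 0 < h ∧ h < δ ∧ Literature.NumberTheory.LFunctions.weilGroundEnergy a - Literature.NumberTheory.LFunctions.weilGroundEnergy (a + h) ≤ h * (K * Literature.NumberTheory.LFunctions.weilGroundEnergy a + η)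

/-- item stmt-RiemannHypothesis-1039 · crux · rank 3 · closed · proved by Summit.RiemannHypothesis.RiemannHypothesis.Theorems.WeilWindowFlowWindowLipschitz.WindowLipschitz_proof (prover) · by planner
why it might fail: ε = L²-normalised bottom (Bombieri Pb 2): minimiser regularity OPEN (viscosity remark p.12; Lemma 5's edge Diracs are for the W^{1,2} Pb 1). Prime-free bottom is Lipschitz by exact scaling; a vertical tangent can only come from prime terms k(log n) of near-minimisers, energy giving O(1/√log(1/h)).
sources: Bombieri2000Weil (Problem 2 + viscosity remark PDF p.12; Thm 3 p.14; Thm 5 p.16: continuity only; Lemma 5 p.17 is for Problem 1), arXiv:2106.01715 (§§2.2–2.4: kinks of the smallest eigenvalue at prime-power entries μ = 2,3,4,5,7; §6 near-prolate eigenvectors), arXiv:2006.13771 (ConnesConsani2021: archimedean form vs prolate/Sonin structure), lean: Literature.NumberTheory.LFunctions.weilGroundEnergy (sInf over smooth g, ∫‖g‖²=1)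
[crux] Unconditional regularity = the quantitative Hadamard checkpoint: the window bottom eps is
locally Lipschitz on (0, oo) (one-sided form suffices, eps is antitone). Bombieri2000Weil Thm 5
proves only continuity (left: dilation of a minimiser; right: compactness of Thm 3); a Lipschitz
bound asks that the dilation derivative of Q at minimisers be bounded by L(b0, A)||phi||^2, which by
Lemma 5 (D^2 f = bounded + edge Diracs, f in C^{1,1} inside) is a statement about edge values of
extremals, uniform in the window. A crude minimiser-free argument (translation modulus from the
log-Sobolev archimedean energy) gives only a 1/sqrt(log(1/h)) modulus. Informative either way: a
vertical tangent of eps kills locally BOUNDED leakage rates. -/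
@[route_item "route-RiemannHypothesis-WeilWindowFlow", crux]
def WindowLipschitz : Prop :=
  ∀ b₀ A : ℝ, 0 < b₀ → b₀ ≤ A → ∃ L : ℝ, ∀ b a : ℝ, b₀ ≤ b → b ≤ a → a ≤ A → Literature.NumberTheory.LFunctions.weilGroundEnergy b - Literature.NumberTheory.LFunctions.weilGroundEnergy a ≤ L * (a - b)

-- `WindowLipschitz` holds: proved by `Summit.RiemannHypothesis.RiemannHypothesis.Theorems.WeilWindowFlowWindowLipschitz.WindowLipschitz_proof` (its module imports this route file, so no `_holds` link can be stated here).

/-- item stmt-RiemannHypothesis-14754 · crux · rank 5 · open · by planner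
why it might fail: RH-strength given WindowLipschitz: false iff ε has a conjugate point (¬RH: exists_weilGroundEnergy_neg_of_not_riemannHypothesis) or, under RH, ε′ is unbounded at differentiability points piling up at an entry a=(log n)/2 (j005651: ε′ continuous through p=2, no vertical tangent on [0.15,1.2])
sources: Bombieri2000Weil (Thm 5 dilation variation, PDF p.16), arXiv:2106.01715 (§§2.3–2.5: bottom across p=2, log s linear in e^L), arXiv:2206.03682 (Suzuki2023 Thm 1.4), lean: Summit.RiemannHypothesis.Cruxes.GronwallLeakage.Negative.gronwallLeakage_iff_pos_and_logAC (Theorems/GronwallLeakage/Negative/Structure.lean), lean: Cruxes/DiniLeakage/Disproof.lean diniLeakage_iff_rh_and_windowLipschitz, diniLeakage_of_pos_of_lowerRightLipschitz, kit: j005651 (Cruxes/WindowLipschitz/Numerics-r1-k1.md)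
[crux] The RH-strength half of the rank-2 crux DiniLeakage in its weakest, pointwise-derivative
form: on every compact window range [b0, A] in (0, oo) there is K with -eps'(a) <= K eps(a) at every
window a in [b0, A] where eps = weilGroundEnergy is differentiable and still positive. By the
log-Hadamard formula -eps'(a) = kappa (edge coefficient of the ground state)^2 (numerically exact,
job j005651, Cruxes/WindowLipschitz/Numerics-r1-k1.md) it says: a true minimiser's edge amplitude is
controlled by its own energy — the leakage bet stripped of every regularity question (a.e.
differentiability and 'no singular drop' belong to WindowLipschitz). EXACT SPLIT, kernel-checkable:
DiniLeakage <-> WindowLipschitz ∧ DerivLeakage modulo proved facts (=>: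
diniLeakage_iff_rh_and_windowLipschitz in Cruxes/DiniLeakage/Disproof.lean with strictUnderRH_proof
— at a differentiability point the Dini bound reads -eps' <= K eps; <=: item LipschitzDerivGlue).
ALONE it does not give RH: without absolute continuity eps could reach a conjugate point through a
singular (Cantor-type) drop with eps' = 0 at every differentiability point — which is exactly why
WindowLipschitz is load-bearing for closes. Honours -/
@[route_item "route-RiemannHypothesis-WeilWindowFlow"]
def DerivLeakage : Prop :=
  ∀ b₀ A : ℝ, 0 < b₀ → b₀ ≤ A → ∃ K : ℝ, ∀ a : ℝ, b₀ ≤ a → a ≤ A → 0 < Literature.NumberTheory.LFunctions.weilGroundEnergy a → DifferentiableAt ℝ Literature.NumberTheory.LFunctions.weilGroundEnergy a → -deriv Literature.NumberTheory.LFunctions.weilGroundEnergy a ≤ K * Literature.NumberTheory.LFunctions.weilGroundEnergy a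

/-- item stmt-RiemannHypothesis-1040 · support · rank 4 · closed · proved by Summit.RiemannHypothesis.RiemannHypothesis.Theorems.primeTwoWindow_proof @ 6dc740d86dc0 (prover) · by planner
why it might fail: Needs eps((log 2)/2) > 0 STRICTLY (the tree's certificate gives >= 0) and right-continuity of the smooth-class eps at the dyadic point, or a new certificate with the p = 2 term; false iff the archimedean form degenerates on the dyadic window and p = 2 drives eps negative at once (would refute RH).
sources: ConnesConsani2021, arXiv:2106.01715, Yoshida1992, doi:10.4171/elm/37/3, Bombieri2000Weil
[crux] The first Groenwall step past the proved archimedean rung: Weil positivity holds on SOME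
window [-a, a] with 2a > log 2, i.e. with the prime 2 genuinely present in W(g*g~). Soft route:
StrictArchimedeanBottom (0 < eps((log 2)/2)) + right-continuity of eps at the dyadic point
(WindowContinuity) give eps > 0 slightly beyond, hence WeilPositivityOn a
(weilGroundEnergy_nonneg_iff_holds). Hard route: a kernel certificate including the p = 2 term (as
WeilPositivityCertificate*.lean). Numerics: p = 2 lowers but does not kill the bottom for e^L in (2,
2.27) (arXiv:2106.01715 §2.3, Fig. testeven2). Nothing unconditional is known in print beyond the
Yoshida–Bombieri range (doi:10.4171/elm/37/3 p.17); strictly weaker than WeilPos's crux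
WeilPositivityOn ((log 3)/2) and implied by RH. -/
@[route_item "route-RiemannHypothesis-WeilWindowFlow"]
def PrimeTwoWindow : Prop :=
  ∃ a : ℝ, Real.log 2 / 2 < a ∧ Literature.NumberTheory.LFunctions.WeilPositivityOn a

-- `PrimeTwoWindow` holds: proved by `Summit.RiemannHypothesis.RiemannHypothesis.Theorems.primeTwoWindow_proof` @ 6dc740d86dc0 (its module imports this route file, so no `_holds` link can be stated here).

/-- item stmt-RiemannHypothesis-1041 · support · rank 6 · closed · proved by Summit.RiemannHypothesis.RiemannHypothesis.Theorems.windowContinuity_proof @ 28940a97442f (prover) · by planner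
sources: Bombieri2000Weil
[support] Continuity of the window bottom in the tree's normalisation (inf over SMOOTH test
functions with tsupport in Icc (-a) a). Known in the L2 class: Bombieri2000Weil Thm 5
(left-continuity by dilating a minimiser; works verbatim for smooth near-minimisers) and the
compactness/lower-semicontinuity argument of Thm 3 (right-continuity); the transfer smooth-inf =
L2-inf on a fixed window is H^log-density of C_c^oo. Needed by DiniGlue and by the soft proof of
PrimeTwoWindow. -/
@[route_item "route-RiemannHypothesis-WeilWindowFlow"]
def WindowContinuity : Prop :=
  ∀ a : ℝ, 0 < a → ContinuousAt Literature.NumberTheory.LFunctions.weilGroundEnergy a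

-- `WindowContinuity` holds: proved by `Summit.RiemannHypothesis.RiemannHypothesis.Theorems.windowContinuity_proof` @ 28940a97442f (its module imports this route file, so no `_holds` link can be stated here).

/-- item stmt-RiemannHypothesis-1042 · support · rank 7 · closed · proved by Summit.RiemannHypothesis.RiemannHypothesis.Theorems.strictArchimedeanBottom_proof (prover) · by planner
sources: Yoshida1992, ConnesConsani2021, arXiv:2106.01715, Bombieri2000Weil
[support] Strict positivity of the bottom at the dyadic (archimedean) window: eps((log 2)/2) > 0.
The tree proves >= 0 (weilPositivityOn_log_two_half_holds, kernel certificate; Yoshida1992 Thm 1;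
ConnesConsani2021 Thm 1). Strictness: either re-run the certificate with slack delta ||g||_2^2
(numerically the bottom is ~1e-3 at e^L = 2, extrapolating arXiv:2106.01715 §2.5: < 6e-8 at e^L = 3
with log s linear in e^L), or attainment (Bombieri2000Weil Thm 3) + definiteness of the archimedean
form on the dyadic window (no kernel vector). Anchor of the Groenwall flow at the last prime-free
window and input of PrimeTwoWindow. -/
@[route_item "route-RiemannHypothesis-WeilWindowFlow"]
def StrictArchimedeanBottom : Prop :=
  0 < Literature.NumberTheory.LFunctions.weilGroundEnergy (Real.log 2 / 2)

-- `StrictArchimedeanBottom` holds: proved by `Summit.RiemannHypothesis.RiemannHypothesis.Theorems.strictArchimedeanBottom_proof` (its module imports this route file, so no `_holds` link can be stated here).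

/-- item stmt-RiemannHypothesis-1043 · support · rank 8 · closed · proved by Summit.RiemannHypothesis.RiemannHypothesis.Theorems.strictUnderRH_proof (prover) · by planner
sources: Bombieri2000Weil, Titchmarsh1986, doi:10.2307/3062132
[support] Calibration: under RH the bottom is STRICTLY positive at every window (so GronwallLeakage
is RH plus regularity, not stronger). Proof idea: by the explicit formula under RH, Q(g) = Sum_gamma
m |g^(1/2+i gamma)|^2 >= Sum over any sub-family; zeta ordinates contain a separated subsequence of
density > a/pi (Riemann–von Mangoldt + Littlewood's gap theorem, Titchmarsh1986 §9.12), which is a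
SAMPLING set for PW_a (Beurling; Jaffard–Seip; Ortega-Cerdà–Seip 'Fourier frames',
doi:10.2307/3062132), giving Q(g) >= c(a)||g||_2^2. Shared engine with card weil-ladder-adversary.
Alternative: attainment (Bombieri2000Weil Thm 3) + uniqueness sets. -/
@[route_item "route-RiemannHypothesis-WeilWindowFlow"]
def StrictUnderRH : Prop :=
  Summit.RiemannHypothesis → ∀ a : ℝ, 0 < a → 0 < Literature.NumberTheory.LFunctions.weilGroundEnergy a

-- `StrictUnderRH` holds: proved by `Summit.RiemannHypothesis.RiemannHypothesis.Theorems.strictUnderRH_proof` (its module imports this route file, so no `_holds` link can be stated here).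

/-- item stmt-RiemannHypothesis-1044 · support · rank 9 · closed · proved by Summit.RiemannHypothesis.RiemannHypothesis.Theorems.WeilWindowFlowDiniGlue.diniGlue_proof (prover) · by planner
sources: Bombieri2000Weil
[support] Real-analysis glue: from the upper-Dini leakage bound with K uniform on compact ranges and
continuity of eps, the Dini monotonicity lemma (continuous f with D^+ f >= -K on [alpha, beta) is
K-Lipschitz from below; Mathlib: image_le_of_liminf_slope_right_le_deriv_boundary-style lemmas)
gives log eps(a) >= log eps(b) - K (a - b) wherever eps > 0; the PROVED coercive anchor
weilQuadratic_coercive (eps -> +oo as a -> 0+) and a first-conjugate-point argument exclude eps <=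
0; a piecewise-constant C (K on dyadic blocks of (0, oo)) then witnesses GronwallLeakage. -/
@[route_item "route-RiemannHypothesis-WeilWindowFlow"]
def DiniGlue : Prop :=
  DiniLeakage → WindowContinuity → GronwallLeakage

-- `DiniGlue` holds: proved by `Summit.RiemannHypothesis.RiemannHypothesis.Theorems.WeilWindowFlowDiniGlue.diniGlue_proof` (its module imports this route file, so no `_holds` link can be stated here).

/-- item stmt-RiemannHypothesis-14755 · support · rank 10 · closed · proved by Summit.RiemannHypothesis.RiemannHypothesis.Theorems.WeilWindowFlowLipschitzDerivGlue.lipschitzDerivGlue_proof (prover) · by planner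
sources: Bombieri2000Weil, Mathlib: AbsolutelyContinuousOnInterval.integral_deriv_eq_sub, LipschitzOnWith → AbsolutelyContinuousOnInterval, lean: Cruxes/DiniLeakage/Disproof.lean diniLeakage_of_pos_of_lowerRightLipschitz
[support] [glue] Exact split of the rank-2 crux: WindowLipschitz → DerivLeakage → DiniLeakage, so
that WindowLipschitz feeds the deciding theorem (→ DiniGlue → GronwallLeakage → closes). Proof plan
(real analysis, size S/M, all tools in Mathlib): (1) anchor exists_one_le_weilGroundEnergy (eps(a0)
>= 1 at some small a0 > 0, Theorems/WeilWindowFlowDiniGlue.lean) and windowContinuity_proof; (2) no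
conjugate point: if a* were the first zero of eps, then on [a0, a*] F := eps · exp(K ·) is
absolutely continuous (WindowLipschitz gives LipschitzOnWith on [a0, a*], hence
AbsolutelyContinuousOnInterval) with F' = (eps' + K eps) e^{K·} >= 0 at a.e. point (DerivLeakage at
the a.e. differentiability points, eps > 0 before a*; K := max K 0), so
AbsolutelyContinuousOnInterval.integral_deriv_eq_sub (or integral_deriv_mul_eq_sub) gives eps(a*) >=
eps(a0) e^{-K(a* - a0)} > 0, contradiction — hence eps > 0 on (0, oo); (3) Dini form: on [b0, A] put
m := min eps > 0 (continuity on a compact) and L := a Lipschitz constant of eps on [b0, A+1]; for 0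
< h < 1, eps(a) - eps(a+h) <= L h <= h (L/m) eps(a) <= h ((L/m) eps(a) + eta), i.e. DiniLeakage with
K = L/m (cf. diniLeakage_of_pos_of_lowerRightLipschitz a -/
@[route_item "route-RiemannHypothesis-WeilWindowFlow"]
def LipschitzDerivGlue : Prop :=
  WindowLipschitz → DerivLeakage → DiniLeakage

-- `LipschitzDerivGlue` holds: proved by `Summit.RiemannHypothesis.RiemannHypothesis.Theorems.WeilWindowFlowLipschitzDerivGlue.lipschitzDerivGlue_proof` (its module imports this route file, so no `_holds` link can be stated here).

/-- item stmt-RiemannHypothesis-1045 · assembly · rank 1 · closed · proved by Summit.RiemannHypothesis.RiemannHypothesis.Theorems.weilWindowFlow_assembly_direct @ a2447a268549 (prover) · by planner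
sources: Bombieri2000Weil, Weil1952, Yoshida1992
[assembly] Provable now from proved tree facts: weilQuadratic_coercive 1 gives a0 > 0 with Q >=
||g||^2 on windows a <= a0, so eps(a0) >= 1 > 0 (le_csInf; the unit sphere of test functions on
[-a0, a0] is nonempty); GronwallLeakage gives eps(a) >= eps(a0) exp(-int) > 0 for a >= a0;
weilGroundEnergy_nonneg_iff_holds turns eps(a) >= 0 into WeilPositivityOn a; WeilPositivityOn.mono
covers a < a0; riemannHypothesis_iff_forall_weilPositivityOn.mpr (weil_criterion_holds; Yoshida's
criterion) gives RiemannHypothesis = Summit.RiemannHypothesis (Summit.RiemannHypothesis_iff). -/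
@[route_item "route-RiemannHypothesis-WeilWindowFlow"]
def Assembly : Prop :=
  GronwallLeakage → Summit.RiemannHypothesis

-- `Assembly` holds: proved by `Summit.RiemannHypothesis.RiemannHypothesis.Theorems.weilWindowFlow_assembly_direct` @ a2447a268549 (its module imports this route file, so no `_holds` link can be stated here).

/-! D-0027 §2.1 — DECIDING THEOREM (planner-authored via `route open/edit --closes-file`; by planner-rbadge-RiemannHypothesis-WeilWindowFlo-6b196cf8-g2-0 2026-08-15T16:19:53Z):
its hypotheses are this route's items and its conclusion the sub-problem Statement (glue_lint), and it elaborates with this file. -/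

@[closes "route-RiemannHypothesis-WeilWindowFlow"] theorem closes (hX : GronwallLeakage) : _root_.Summit.RiemannHypothesis := by
  -- D-0027 §2.1 deciding theorem: the thesis X = `GronwallLeakage` alone implies RH, using only
  -- PROVED tree facts (no Assembly item needed):
  --  * `weilQuadratic_coercive 0` (Bombieri 2000 Thm 12): Weil positivity on every window a ≤ a₀,
  --    hence ε(a₀) ≥ 0 by `weilGroundEnergy_nonneg_iff_holds` (junk-robust, no strictness needed);
  --  * the Grönwall leakage law transports ε ≥ 0 from a₀ to every a ≥ a₀ (ε(a) ≥ ε(a₀)·exp(−∫C) ≥ 0);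
  --  * `weilGroundEnergy_nonneg_iff_holds` turns ε(a) ≥ 0 back into `WeilPositivityOn a`;
  --  * Yoshida's criterion `riemannHypothesis_iff_forall_weilPositivityOn` (from `weil_criterion_holds`)
  --    and `Summit.RiemannHypothesis_iff` conclude.
  -- (Same argument as the candidate proofs attached to item stmt-RiemannHypothesis-1045 by
  --  refuter f1c63249 and grounder g15-24; axioms: propext, Classical.choice, Quot.sound.)
  refine (_root_.Summit.RiemannHypothesis_iff).2 ?_
  refine (_root_.Literature.NumberTheory.LFunctions.riemannHypothesis_iff_forall_weilPositivityOn).2 ?_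
  obtain ⟨a₀, ha₀, hcoer⟩ := _root_.Literature.NumberTheory.LFunctions.weilQuadratic_coercive 0
  have hiff : ∀ {a : ℝ}, 0 < a →
      (0 ≤ _root_.Literature.NumberTheory.LFunctions.weilGroundEnergy a ↔
        _root_.Literature.NumberTheory.LFunctions.WeilPositivityOn a) :=
    _root_.Literature.NumberTheory.LFunctions.weilGroundEnergy_nonneg_iff_holds
  have hsmall : ∀ a : ℝ, 0 < a → a ≤ a₀ →
      _root_.Literature.NumberTheory.LFunctions.WeilPositivityOn a := by
    intro a ha hle g hg hsupp
    have h := hcoer a ha hle g hg hsupp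
    simpa using h
  intro a ha
  by_cases hle : a ≤ a₀
  · exact hsmall a ha hle
  · have hlt : a₀ ≤ a := le_of_lt (lt_of_not_ge hle)
    have h0 : 0 ≤ _root_.Literature.NumberTheory.LFunctions.weilGroundEnergy a₀ :=
      (hiff ha₀).2 (hsmall a₀ ha₀ le_rfl)
    obtain ⟨C, hC⟩ := hX
    have h1 := (hC a₀ a ha₀ hlt).2
    have h2 : 0 ≤ _root_.Literature.NumberTheory.LFunctions.weilGroundEnergy a :=
      le_trans (mul_nonneg h0 (Real.exp_pos _).le) h1
    exact (hiff ha).1 h2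

end Summit.RiemannHypothesis.RiemannHypothesis.Theses.WeilWindowFlow
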